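import Summits.AtomisticToContinuum.FouriersLaw.Theorems.OddSectorIrreversibilityResponseDensityHarrisUniform
import Summits.AtomisticToContinuum.FouriersLaw.Theorems.OddSectorIrreversibilityResponseDensityAssemblyMixing
import Literature.MathematicalPhysics.KineticTheory.LangevinChainDynkin

/-!
# The uniform-mixing hypothesis of `ResponseDensity` from a uniform drift and a uniform minorisation

Item stmt-AtomisticToContinuum-9144 (`ResponseDensity`, route `OddSectorIrreversibility`, sub-problem
`FouriersLaw` of `AtomisticToContinuum`). After `…AssemblyMixing.lean` the item is reduced to the single
input `hUM`: the exponential convergence (2.5) of the transition semigroups with baths at `T ± δ/2`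
with constants UNIFORM in `|δ| < δ₀`. By the uniform Harris theorem (`…HarrisUniform.lean`) and the
a-priori bound (3.4) (whose constants are explicit and uniform), `hUM` follows from two smaller
uniform inputs at ONE time `t₀ > 0`, for the Lyapunov function `V = e^{ϑH}`:

* `UDRIFT` — a uniform geometric drift `P^δ_{t₀} V ≤ γ' V + K` (`γ' < 1`) for all `|δ| < δ₀`;
* `UMINOR` — a uniform minorisation `P^δ_{t₀}(x, ·) ≥ α ν_δ` on `{V ≤ R}` (`ν_δ` probability
  measures, `α > 0`, `2K < (1-γ')R`) for all `|δ| < δ₀`.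

* `pinnedChain_uniformMixing_of_uniformDriftMinor` — `UDRIFT ∧ UMINOR ⟹ hUM`;
* `responseDensity_of_uniformDriftMinor` — **`ResponseDensity` from `UDRIFT ∧ UMINOR` at every
  `(T, N ≥ 1)`** (with `responseDensity_of_uniformMixing`).

No definitions.
-/

noncomputable section

open MeasureTheory ProbabilityTheory Filter Topology Set
open scoped NNReal ENNReal

namespace Summit.AtomisticToContinuum.FouriersLaw.Theorems

open Literature.MathematicalPhysics.KineticTheory.HeatConduction
open Literature.Probability.Process Literature.MathematicalPhysics.KineticTheory OscillatorChain

variable {N : ℕ}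

section Reduction

variable {ω₂ lam β γ : ℝ} (hω : 0 < ω₂) (hl : 0 ≤ lam) (hβ : 0 ≤ β) (hγ : 0 < γ) (hN : 0 < N)
  {T : ℝ} (hT : 0 < T) {δ₀ : ℝ} (hδ₀T : δ₀ < 2 * T)
  {ϑ : ℝ} (hϑ : 0 < ϑ) (hϑT : ϑ < 1 / (T + δ₀ / 2))
include hω hl hβ hγ hN hT hδ₀T hϑ hϑT

/-- **`hUM` from a uniform drift and a uniform minorisation at one time.** For the pinned chain
(`ω₂, γ > 0`, `lam, β ≥ 0`, `N ≥ 1`, `T > 0`, `δ₀ < 2T`, `0 < ϑ < 1/(T + δ₀/2)`), with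
`V = e^{ϑH}` and the kernels `P^δ_t` with baths at `T ± δ/2`: if at some `t₀ > 0` the kernels
`P^δ_{t₀}`, `|δ| < δ₀`, satisfy `P^δ_{t₀} V ≤ γ' V + K` (`γ' < 1`) and `P^δ_{t₀}(x,·) ≥ α ν_δ` on
`{V ≤ R}` (`ν_δ` probability measures, `α > 0`, `2K < (1-γ')R`), then (2.5) holds with constants
uniform in `|δ| < δ₀`: `|P^δ_t f(z) - ν(f)| ≤ C_m e^{ϑH(z)} e^{-ct}` for every invariant probability
measure `ν` of `P^δ`, continuous `|f| ≤ e^{ϑH}`, all `z`, `t`. -/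
theorem pinnedChain_uniformMixing_of_uniformDriftMinor {t₀ : ℝ≥0} (ht₀ : 0 < t₀) {γ' K : ℝ≥0}
    (hγ' : γ' < 1) {α R : ℝ≥0} (hα : 0 < α) (hR : 2 * K < (1 - γ') * R)
    (hdrift : ∀ δ : ℝ, |δ| < δ₀ → ∀ z : PhaseSpace N,
      ∫⁻ y, ENNReal.ofReal (Real.exp (ϑ * (pinnedChain ω₂ lam β γ).hamiltonian N y))
          ∂((pinnedChain ω₂ lam β γ).transitionKernel N (T + δ / 2) (T - δ / 2) t₀ z) ≤
        (γ' : ℝ≥0∞) * ENNReal.ofReal (Real.exp (ϑ * (pinnedChain ω₂ lam β γ).hamiltonian N z)) + K)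
    (hminor : ∀ δ : ℝ, |δ| < δ₀ → ∃ ν : Measure (PhaseSpace N), IsProbabilityMeasure ν ∧
      ∀ x : PhaseSpace N, Real.exp (ϑ * (pinnedChain ω₂ lam β γ).hamiltonian N x) ≤ R →
        α • ν ≤ (pinnedChain ω₂ lam β γ).transitionKernel N (T + δ / 2) (T - δ / 2) t₀ x) :
    ∃ Cm c : ℝ, 0 ≤ Cm ∧ 0 < c ∧
      ∀ δ : ℝ, |δ| < δ₀ → ∀ ν : Measure (PhaseSpace N), IsProbabilityMeasure ν →
        (∀ t : ℝ≥0, ν.bind ((pinnedChain ω₂ lam β γ).transitionKernel N (T + δ / 2) (T - δ / 2) t) = ν) →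
        ∀ (z : PhaseSpace N) (t : ℝ≥0) (f : PhaseSpace N → ℝ), Continuous f →
          (∀ y, |f y| ≤ Real.exp (ϑ * (pinnedChain ω₂ lam β γ).hamiltonian N y)) →
          |(∫ y, f y ∂((pinnedChain ω₂ lam β γ).transitionKernel N (T + δ / 2) (T - δ / 2) t z)) -
              ∫ y, f y ∂ν| ≤
            Cm * Real.exp (ϑ * (pinnedChain ω₂ lam β γ).hamiltonian N z) * Real.exp (-c * t) := by
  -- the family of semigroups indexed by `δ ∈ (-δ₀, δ₀)`
  set ι := {δ : ℝ // |δ| < δ₀}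
  set κ : ι → ℝ≥0 → Kernel (PhaseSpace N) (PhaseSpace N) :=
    fun i t => (pinnedChain ω₂ lam β γ).transitionKernel N (T + i.1 / 2) (T - i.1 / 2) t with hκ
  haveI : ∀ (i : ι) (t : ℝ≥0), IsMarkovKernel (κ i t) := fun i t =>
    pinnedChain_isMarkovKernel_transitionKernel hω hl hβ hγ.le N _ _ t
  have h_zero : ∀ i : ι, κ i 0 = Kernel.id := fun i =>
    pinnedChain_transitionKernel_zero hω hl hβ hγ.le N _ _
  have h_add : ∀ (i : ι) (s t : ℝ≥0), κ i (s + t) = κ i t ∘ₖ κ i s := fun i s t =>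
    pinnedChain_transitionKernel_add hω hl hβ hγ.le N _ _ s t
  -- the Lyapunov function
  set Hm := (pinnedChain ω₂ lam β γ).hamiltonian N with hHm
  have hHc : Continuous Hm := (pinnedChain_contDiff_hamiltonian ω₂ lam β γ N (n := 0)).continuous
  set V : PhaseSpace N → ℝ≥0 := fun z => (Real.exp (ϑ * Hm z)).toNNReal with hVdef
  have hV : Measurable V := (continuous_real_toNNReal.comp (Real.continuous_exp.comp
    (continuous_const.mul hHc))).measurable
  have hVcoe : ∀ z, (V z : ℝ≥0∞) = ENNReal.ofReal (Real.exp (ϑ * Hm z)) := fun z => rfl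
  have hVreal : ∀ z, (V z : ℝ) = Real.exp (ϑ * Hm z) := fun z =>
    Real.coe_toNNReal _ (Real.exp_pos _).le
  -- the uniform drift and minorisation in the abstract form
  have hdrift' : ∀ (i : ι) z, ∫⁻ y, (V y : ℝ≥0∞) ∂(κ i t₀ z) ≤ (γ' : ℝ≥0∞) * V z + K := by
    intro i z
    simp only [hVcoe]
    exact hdrift i.1 i.2 z
  let νf : ι → Measure (PhaseSpace N) := fun i => Classical.choose (hminor i.1 i.2)
  have hνf : ∀ i : ι, IsProbabilityMeasure (νf i) ∧ ∀ x : PhaseSpace N, Real.exp (ϑ * Hm x) ≤ R →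
      α • νf i ≤ κ i t₀ x := fun i => Classical.choose_spec (hminor i.1 i.2)
  haveI : ∀ i : ι, IsProbabilityMeasure (νf i) := fun i => (hνf i).1
  have hminor' : ∀ (i : ι) x, V x ≤ R → α • νf i ≤ κ i t₀ x := by
    intro i x hx
    refine (hνf i).2 x ?_
    have : ((V x : ℝ≥0) : ℝ) ≤ R := by exact_mod_cast hx
    rwa [hVreal] at this
  -- the flow bound (3.4), uniform: `C⋆ = ϑγ(2T)`
  have hbath : ∀ i : ι, 0 < T + i.1 / 2 ∧ 0 < T - i.1 / 2 ∧ ϑ < 1 / max (T + i.1 / 2) (T - i.1 / 2) :=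
    fun i => bath_facts_of_abs_lt hδ₀T hϑT i.2
  have hflow : ∀ (i : ι) (s : ℝ≥0) (x : PhaseSpace N),
      ∫⁻ y, (V y : ℝ≥0∞) ∂(κ i s x) ≤ ENNReal.ofReal (Real.exp (ϑ * γ * (2 * T) * s)) * V x := by
    intro i s x
    obtain ⟨hL, hR', hϑ'⟩ := hbath i
    have h := lintegral_exp_mul_hamiltonian_pinnedChainSemigroup_le hω hl hβ hγ.le hN hL.le hR'.le hL hR'
      hϑ hϑ' s x
    simp only [hVcoe]
    refine h.trans (le_of_eq ?_)
    rw [ENNReal.ofReal_mul (Real.exp_pos _).le]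
    congr 2
    ring
  haveI : Nonempty (PhaseSpace N) := ⟨0⟩
  obtain ⟨C, c, hC, hc, hconv⟩ := uniformHarris_semigroup κ h_zero h_add hV ht₀ hγ' hdrift' hα hR νf hminor'
    (by positivity : (0 : ℝ) ≤ ϑ * γ * (2 * T)) hflow
  refine ⟨2 * C, c, by positivity, hc, fun δ hδ ν hν hinv z t f hf hfb => ?_⟩
  have h := hconv ⟨δ, hδ⟩ ν hν (fun t => hinv t) z t f hf.measurable (fun y => by rw [hVreal]; exact hfb y)
  rw [hVreal] at h
  have hV1 : 1 ≤ Real.exp (ϑ * Hm z) :=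
    Real.one_le_exp (mul_nonneg hϑ.le (pinnedChain_hamiltonian_nonneg hω.le hl hβ γ N z))
  calc _ ≤ C * (1 + Real.exp (ϑ * Hm z)) * Real.exp (-c * t) := h
    _ ≤ C * (2 * Real.exp (ϑ * Hm z)) * Real.exp (-c * t) := by
        refine mul_le_mul_of_nonneg_right (mul_le_mul_of_nonneg_left (by linarith) hC.le) (Real.exp_pos _).le
    _ = _ := by ring

end Reduction

/-- **`ResponseDensity` from a uniform drift and a uniform minorisation near equilibrium.** If for
all admissible parameters, every `T > 0` and every `N ≥ 1` there are `δ₀, ϑ` with `0 < δ₀ < 2T`,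
`0 < ϑ < 1/(T + δ₀/2)`, `2ϑ < 1/T`, a time `t₀ > 0` and constants `γ' < 1`, `K`, `α > 0`, `R` with
`2K < (1-γ')R` such that the kernels `P^δ_{t₀}` with baths at `T ± δ/2`, `|δ| < δ₀`, satisfy the
uniform drift `P^δ_{t₀} e^{ϑH} ≤ γ' e^{ϑH} + K` and the uniform minorisation
`P^δ_{t₀}(x,·) ≥ α ν_δ` on `{e^{ϑH} ≤ R}`, then `ResponseDensity` holds. -/
theorem responseDensity_of_uniformDriftMinor
    (H : ∀ ω₂ lam β γ : ℝ, 0 < ω₂ → 0 < lam → 0 < β → 0 < γ → ∀ T : ℝ, 0 < T → ∀ N : ℕ, 0 < N →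
      ∃ (δ₀ ϑ : ℝ), 0 < δ₀ ∧ δ₀ < 2 * T ∧ 0 < ϑ ∧ ϑ < 1 / (T + δ₀ / 2) ∧ 2 * ϑ < 1 / T ∧
        ∃ (t₀ : ℝ≥0) (γ' K α R : ℝ≥0), 0 < t₀ ∧ γ' < 1 ∧ 0 < α ∧ 2 * K < (1 - γ') * R ∧
          (∀ δ : ℝ, |δ| < δ₀ → ∀ z : PhaseSpace N,
            ∫⁻ y, ENNReal.ofReal (Real.exp (ϑ * (pinnedChain ω₂ lam β γ).hamiltonian N y))
                ∂((pinnedChain ω₂ lam β γ).transitionKernel N (T + δ / 2) (T - δ / 2) t₀ z) ≤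
              (γ' : ℝ≥0∞) * ENNReal.ofReal (Real.exp (ϑ * (pinnedChain ω₂ lam β γ).hamiltonian N z)) + K) ∧
          (∀ δ : ℝ, |δ| < δ₀ → ∃ ν : Measure (PhaseSpace N), IsProbabilityMeasure ν ∧
            ∀ x : PhaseSpace N, Real.exp (ϑ * (pinnedChain ω₂ lam β γ).hamiltonian N x) ≤ R →
              α • ν ≤ (pinnedChain ω₂ lam β γ).transitionKernel N (T + δ / 2) (T - δ / 2) t₀ x)) :
    Summit.AtomisticToContinuum.FouriersLaw.Theses.OddSectorIrreversibility.ResponseDensity := by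
  refine responseDensity_of_uniformMixing fun ω₂ lam β γ hω hl hβ hγ T hT N hN => ?_
  obtain ⟨δ₀, ϑ, hδ₀, hδ₀T, hϑ, hϑT, h2ϑ, t₀, γ', K, α, R, ht₀, hγ', hα, hR, hdrift, hminor⟩ :=
    H ω₂ lam β γ hω hl hβ hγ T hT N hN
  obtain ⟨Cm, c, hCm, hc, hUM⟩ := pinnedChain_uniformMixing_of_uniformDriftMinor hω hl.le hβ.le hγ hN hT
    hδ₀T hϑ hϑT ht₀ hγ' hα hR hdrift hminor
  exact ⟨δ₀, ϑ, Cm, c, hδ₀, hδ₀T, hϑ, hϑT, h2ϑ, hCm, hc, hUM⟩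

end Summit.AtomisticToContinuum.FouriersLaw.Theorems

end
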